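import Summits.BirchSwinnertonDyer.Rank1Residual.Additive.KatoDescentRankOneCountTame
import Literature.NumberTheory.EllipticCurves.Kato2004.IwasawaH2FineSelmerDualLoc
import Literature.NumberTheory.EllipticCurves.Kato2004.IwasawaH1RankLeOneProofs
import HarnessLib

set_option autoImplicit false

/-!
# The stub-3 master over a row predicate and COUNT-X₀|tame WITHOUT `Kato2004.thm12_4`: Kato's Thm. 12.4 (2) at the pin of a
# realised descent datum is a tree theorem (seat `bsd-cm-prr-ty1` g17, cell `bsd-cm`; theorems only: no definition, no named
# fact, no instance, no `sorry`)

Part 52 of the seat's kernel cut of the Kato–Perrin-Riou skeletons (cruxes stmt-BirchSwinnertonDyer-19945 / -19223; registered lines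
`kato_perrin_riou_zp` v5 / `kato_perrin_riou_istar` v5, cite stub `stub_printFactsKato : Kato2004.thm12_4 ∧ H2X′ ∧ exists_isNewformOf`).
Companion of Part 51 (`KatoDescentPerrinRiouRatioRankOne.lean`: PR-INV on the rank-one rows without `thm12_4`).

WHERE `thm12_4` ENTERED.  The master E22 `StrictCount.rankOneCountReading_of_facts_of_rowPred` (stub 3's body over a row predicate `R`)
and the tame count E24 `StrictCount.countX₀_tame_of_gzk_of_thm12_4_of_h2x'` each destructure the named fact ONCE,
`⟨hfg, ⟨htf, hrk⟩, -⟩ := h12 W p κ γ hκ hγ I`, and use it ONLY for the instances `Module.Finite Λ I.H`, `Module.IsTorsionFree Λ I.H` and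
`Nontrivial I.H` (from `rank = 1`) that the counting lemmas (`finite_coinvariants_H2_of_iwasawaH2Data`, `exists_kummerLog_range_eq`,
`count_ii_of_iwasawaH2Data`, …) take.  All three are TREE THEOREMS at the pins in play:
* `Module.Finite Λ I.H` — (12.2.1) `Kato2004.IwasawaH1Data.module_finite_of_isCyclotomic` (cell bsd-potss, (14.14.1)-injectivity + compact
  Nakayama, `Kato2004/IwasawaH1ProjZeroKernelProofs.lean`);
* `Module.IsTorsionFree Λ I.H` — `Kato2004.IwasawaH1Data.isTorsionFree` (`Kato2004/IwasawaH1LambdaTorsionFreeProofs.lean`);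
* `Nontrivial I.H` — in the master the pin `Pn` of the REALISED datum `D` carries `Pn.eH D.z` with `D.z ≠ 0` (`KatoDescentDatum.z_ne_zero`,
  a field of the datum), so `Pn.I.H ≠ 0` with no input at all; in COUNT-X₀|tame (a statement over an arbitrary pin) it becomes a
  DISPLAYED binder `Nontrivial I.H →`, discharged by the master at `Pn`.
So this file re-proves both WITHOUT `h12` (same proof texts, the one `obtain` line replaced), keyed to the NAMED Literature fact H2X′
(`Kato2004.exists_iwasawaH2Data_fineSelmerDual_embedding_loc`, p719171) where E24 displayed it:
* §1 `countX₀_tame_of_gzk_of_loc (hGZK) (hloc)` — COUNT-X₀ on the tame rows with the binder `Nontrivial I.H →` inserted before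
  `Function.Injective e₀`; the bijective package from `hloc.exists_bijective_of_eq_bot` + TowerTorsionVanishing, J-matching (E20/E23) and
  EXACT FINE CONTROL (potss) as in E24;
* §2 ★ `rankOneCountReading_of_loc_of_rowPred (R) (hR) (hGZK) (hlev) (hH2X) (hPRinv) (hX₀)` — E22's master with `h12` GONE, `hPRinv` in
  Part 51's rank-one shape (`W.mordellWeilRank = 1 → Finite (Ш W)[p^∞] →` inserted; the master has both from GZK at the row) and
  `hX₀` with the `Nontrivial I.H →` binder; `hH2X` = H2X's statement (fed by `hloc.embedding` in Part 53).
The row heads (tame / CM-tame / `(p, I₀*)` / 𝒞₇, by name and from modularity) are Part 53 (`KatoDescentRankOneCountRowsOfLoc.lean`).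
HONEST LABEL: theorems only, CONDITIONAL on the displayed hypotheses {GZK, lev, H2X/H2X′, PR-INV|rk1, COUNT-X₀|R}; the registered v5
stubs are NOT touched or closed; nothing asserted on 19945 / 19223; Kato's Thm. 12.4 as the tree's named fact is untouched (not
used); no summit statement is proved by this seat; BSD is not proved for any curve.
References: [Kato2004Asterisque] (12.2.1) (p. 220), Thm. 12.4 (2) (p. 221), §13.9 (p. 230), (14.9.1) (p. 239), (14.9.3) (p. 240), §14.14
(14.14.1)–(14.14.2) (p. 243), Lemma 14.15, Prop. 14.16 (p. 244), (17.13.1) (p. 279); [BurnsKuriharaSano2019] Thm. 7.3, Thm. 7.8 (d);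
[BlochKato1990] Def. 3.10, Ex. 3.11; [GreenbergLNM1716] §3 Lemma 3.1, Prop. 3.8; [GrossZagier1986] Thm. I.7.3; [Imai1975] Theorem (p. 12).
-/

noncomputable section

open scoped Classical NumberField BigOperators ContRepresentation

open WeierstrassCurve Field IsDedekindDomain NumberField Rat.HeightOneSpectrum Literature.NumberTheory.EllipticCurves
  Literature.NumberTheory.EllipticCurves.ModularForms
  Literature.NumberTheory.EllipticCurves.Rank1Residual Literature.NumberTheory.EllipticCurves.Rank1Residual.Typed
  Literature.NumberTheory.EllipticCurves.Kato2004 Literature.NumberTheory.EllipticCurves.IwasawaAlgebra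
  Literature.NumberTheory.EllipticCurves.Kato2004.EulerSystemValues
  Literature.NumberTheory.GaloisRepresentations Literature.NumberTheory.GaloisRepresentations.DiscreteGaloisModule
open WeierstrassCurve (galH1Primary kummerMapTorsion)
open Summit.BirchSwinnertonDyer.BirchSwinnertonDyer.Theorems.CongruentShaFreeCutKatoDescentDatumOfH2
  Summit.BirchSwinnertonDyer.BirchSwinnertonDyer.Theorems.CongruentShaFreeCutKatoKummerLogTorsion
  Summit.BirchSwinnertonDyer.BirchSwinnertonDyer.Theorems.TowerTorsionFiniteOrdinary
  Summit.BirchSwinnertonDyer.BirchSwinnertonDyer.Theorems.TowerTorsionVanishing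
  Summit.BirchSwinnertonDyer.BirchSwinnertonDyer.Theorems.ExactFineControl
open Summit.BirchSwinnertonDyer.Rank1Residual Summit.BirchSwinnertonDyer.Rank1Residual.Additive
  Summit.BirchSwinnertonDyer.Rank1Residual.Additive.ContraCount Summit.BirchSwinnertonDyer.Rank1Residual.Additive.LocPKummer
  Summit.BirchSwinnertonDyer.Rank1Residual.Additive.GlobalKummer

namespace Summit.BirchSwinnertonDyer.Rank1Residual.Additive.StrictCount

/-! ## §1 COUNT-X₀ on the tame rows from {GZK, H2X′} with a `Nontrivial 𝐇¹` binder (no `thm12_4`) -/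

section CountTame

/-- **COUNT-X₀|tame ⟸ {GZK, H2X′} — no `Kato2004.thm12_4`.**  E24 `countX₀_tame_of_gzk_of_thm12_4_of_h2x'` with the displayed H2X′
replaced by the NAMED fact `Kato2004.exists_iwasawaH2Data_fineSelmerDual_embedding_loc` and `h12` replaced by the binder
`Nontrivial I.H →` (inserted before `Function.Injective e₀`) plus the tree theorems `IwasawaH1Data.module_finite_of_isCyclotomic` /
`isTorsionFree`; otherwise the same proof: `W(ℚ_{p,∞})[p^∞] = 0` (TowerTorsionVanishing) and H2X′ give a bijective `(J₁, e₁)` over the pin,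
`#(J₀.H2)_Γ = #(J₁.H2)_Γ` by J-matching through the (H2ᶜ)-pinned twin `J₁^ι`, and EXACT FINE CONTROL gives `KatoH2CountAt W p #((X₀)_γ)_Γ`.
[cite: Kato2004Asterisque, §12.2 (12.2.1) (p. 220), Thm. 12.4 (2) (p. 221), (14.9.1) (p. 239), (14.9.3) (p. 240), §14.14 (14.14.1)–(14.14.2) (p. 243), Lemma 14.15 (p. 244), (17.13.1) (p. 279)]
[cite: GreenbergLNM1716, §3 Lemma 3.1, Lemma 3.2 and Prop. 3.8] [cite: Greenberg1989, §0 pp. 101–102] -/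
theorem countX₀_tame_of_gzk_of_loc (hGZK : rank_eq_analyticRank_of_analyticRank_le_one)
    (hloc : exists_iwasawaH2Data_fineSelmerDual_embedding_loc) :
    ∀ (W : WeierstrassCurve ℚ) [W.IsElliptic] [W.IsGloballyMinimal] (p : ℕ) [Fact p.Prime],
      letI : ContinuousSMul ℤ_[p] (W.tateModule p) := TateModule.continuousSMul_padicInt
      ∀ (κ : ZpExtension ℚ p) (γ : absoluteGaloisGroup ℚ), κ.IsCyclotomic → (hγ : κ.IsTopGenerator γ) →
        ∀ (I : IwasawaH1Data W p κ γ) (J₀ : IwasawaH2Data W p κ γ I)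
          (e₀ : (W.fineSelmerDualData κ hγ).X →ₗ[IwasawaAlgebra p] J₀.H2),
          W.analyticRank = 1 → p ≠ 2 → Addv W p → 0 ≤ padicValRat p W.j → ¬ p ∣ W.torsionOrder → Finite W.sha →
          (∀ R : (W.baseChange ℚ_[p]).toAffine.Point, p • R = 0 → R = 0) →
          Nontrivial I.H → Function.Injective e₀ → Finite (J₀.H2 ⧸ LinearMap.range e₀) →
          KatoH2CountAt W p (Nat.card (coinvariants p J₀.H2)) := by
  intro W _ _ p _
  letI : ContinuousSMul ℤ_[p] (W.tateModule p) := TateModule.continuousSMul_padicInt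
  intro κ γ hκ hγ I J₀ e₀ hr hp2 hadd hj htors hsha h4 hnt he₀ hfin₀
  obtain ⟨hmw, -⟩ := hGZK W (by rw [hr])
  have hrank : W.mordellWeilRank = 1 := by rw [hmw, hr]
  haveI := hsha
  have hsha' : Finite (AddCommGroup.primaryComponent W.sha p) := inferInstance
  -- Thm. 12.4 (2) at this pin: tree theorems + the displayed `Nontrivial I.H`
  haveI := IwasawaH1Data.module_finite_of_isCyclotomic hκ hγ I
  haveI := I.isTorsionFree hγ
  haveI : Nontrivial I.H := hnt
  -- the bijective package over THIS pin: H2X′ + `W(ℚ_{p,∞})[p^∞] = 0`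
  have hbot := fixedPoints_kerSubgroup_inf_decomp_eq_bot_of_noPTorsionPadic W p κ (primePlace p)
    (coe_primesEquiv_primePlace p) h4
  obtain ⟨J₁, e₁, hbij⟩ := hloc.exists_bijective_of_eq_bot hγ (primePlace p) hp2 hκ (coe_primesEquiv_primePlace p) hbot I
  haveI : Finite (coinvariants p J₀.H2) := finite_coinvariants_H2_of_iwasawaH2Data W p J₀ hrank hsha'
  haveI hJ₁ : Finite (coinvariants p J₁.H2) := finite_coinvariants_H2_of_iwasawaH2Data W p J₁ hrank hsha'
  -- `#(J₁.H2)_Γ = #((X₀)_γ)_Γ`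
  have hX₀ : Nat.card (coinvariants p (W.fineSelmerDualData κ hγ).X) = Nat.card (coinvariants p J₁.H2) :=
    Nat.card_congr (coinvariantsEquiv (LinearEquiv.ofBijective e₁ hbij)).toEquiv
  -- `#(J₀.H2)_Γ = #(J₁.H2)_Γ`: the twin `J₁^ι` is (H2ᶜ)-pinned; J-matching with `(J₀, e₀)`
  have hfin₁ : Finite (J₁.H2 ⧸ LinearMap.range e₁) := by
    rw [LinearMap.range_eq_top.mpr hbij.2]
    infer_instance
  obtain ⟨J', e', he', hpin'⟩ := exists_involTwist_pinned_contra_of_embedding W p hγ J₁ e₁ hbij.1 hfin₁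
  haveI : Finite (coinvariants p J'.H2) := finite_coinvariants_of_involSemilinear e' he'
  have hmatch := natCard_coinvariants_H2_eq_of_pinned_of_embedding W p hγ J' hpin' J₀ e₀ he₀ hfin₀
  rw [natCard_coinvariants_eq_of_involSemilinear e' he'] at hmatch
  -- exact fine control: `KatoH2CountAt W p #((X₀)_γ)_Γ`
  have hcount := katoH2CountAt_natCard_coinvariants_fineSelmerDual W κ hp2 hκ hγ h4 (W.fineSelmerDualData κ hγ)
  rw [hX₀, hmatch] at hcount
  exact hcount

end CountTame

/-! ## §2 The master over a row predicate from {GZK, lev, H2X} + {PR-INV|rk1, COUNT-X₀|R} (no `thm12_4`) -/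

section Assembly

/-- ★ **STUB 3 OVER A ROW PREDICATE `R W p` from {GZK, `IsNewformOf.level_eq_conductorNorm`, H2X} + {PR-INV|rank one, COUNT-X₀|R} —
no `Kato2004.thm12_4`.**  E22 `rankOneCountReading_of_facts_of_rowPred` with: `h12` REMOVED (the pin `Pn` of the realised datum `D`
has `Module.Finite` / `Module.IsTorsionFree` by the tree theorems `IwasawaH1Data.module_finite_of_isCyclotomic` / `isTorsionFree` and
`Nontrivial Pn.I.H` because `Pn.eH D.z ≠ 0`, `KatoDescentDatum.z_ne_zero`); `hPRinv` in Part 51's rank-one shape (the two binders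
`W.mordellWeilRank = 1 → Finite (Ш W)[p^∞] →` are supplied from GZK at the row); `hX₀` with the binder `Nontrivial I.H →` (supplied at
`Pn`).  The conclusion and the rest of the proof are E22's VERBATIM (second PRRatio witness from the admissible body, K1's bottom-layer
position, LOG-EX/LOG-HOM, the Kummer-log functional and E11's lattice exponent, COUNT-X₀|R at H2X's `(J₀, e₀)` J-matched to `Pn.J`,
Part 32's count identity).  CONDITIONAL; the registered v5 stubs are NOT closed by this theorem.
[cite: Kato2004Asterisque, §12.2 (12.2.1) (p. 220), Thm. 12.4 (2) (p. 221), §13.9 (p. 230), (14.9.1) (p. 239), (14.9.3) (p. 240), §14.14 (14.14.1)–(14.14.2) (p. 243), Lemma 14.15 and Prop. 14.16 (p. 244)]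
[cite: BurnsKuriharaSano2019, Thm. 7.3 (p. 29) and Thm. 7.8 (d) (p. 30)] [cite: BlochKato1990, Def. 3.10 and Ex. 3.11]
[cite: GrossZagier1986, Thm. I.7.3] [cite: Darmon2004, Thm. 3.22] [cite: Imai1975, Theorem (p. 12)] -/
theorem rankOneCountReading_of_loc_of_rowPred (R : WeierstrassCurve ℚ → ℕ → Prop)
    (hR : ∀ (W : WeierstrassCurve ℚ) [W.IsElliptic] [W.IsGloballyMinimal] (p : ℕ) [Fact p.Prime], R W p →
      ∀ v ∈ W.badPlaces (𝓞 ℚ), ((Rat.HeightOneSpectrum.primesEquiv v : Nat.Primes) : ℕ) ≠ p → W.HasAdditiveReductionAt v)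
    (hGZK : rank_eq_analyticRank_of_analyticRank_le_one)
    (hlev : ∀ (N : ℕ) [NeZero N], IsNewformOf.level_eq_conductorNorm (N := N))
    (hH2X : exists_iwasawaH2Data_fineSelmerDual_embedding)
    (hPRinv : ∀ (W : WeierstrassCurve ℚ) [W.IsElliptic] [W.IsGloballyMinimal] (p : ℕ) [Fact p.Prime]
      (ℒ₁ ℒ₂ : ℚ_[p]), W.mordellWeilRank = 1 → Finite (AddCommGroup.primaryComponent W.sha p) →
      Kato2004.PRRatio W p ℒ₁ → Kato2004.PRRatio W p ℒ₂ → ∃ w : ℚ_[p], ‖w‖ = 1 ∧ ℒ₂ = w * ℒ₁)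
    (hX₀ : ∀ (W : WeierstrassCurve ℚ) [W.IsElliptic] [W.IsGloballyMinimal] (p : ℕ) [Fact p.Prime],
      letI : ContinuousSMul ℤ_[p] (W.tateModule p) := TateModule.continuousSMul_padicInt
      ∀ (κ : ZpExtension ℚ p) (γ : absoluteGaloisGroup ℚ), κ.IsCyclotomic → (hγ : κ.IsTopGenerator γ) →
        ∀ (I : IwasawaH1Data W p κ γ) (J₀ : IwasawaH2Data W p κ γ I)
          (e₀ : (W.fineSelmerDualData κ hγ).X →ₗ[IwasawaAlgebra p] J₀.H2),
          W.analyticRank = 1 → p ≠ 2 → Addv W p → 0 ≤ padicValRat p W.j → ¬ p ∣ W.torsionOrder → Finite W.sha →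
          R W p →
          Nontrivial I.H → Function.Injective e₀ → Finite (J₀.H2 ⧸ LinearMap.range e₀) →
          KatoH2CountAt W p (Nat.card (coinvariants p J₀.H2))) :
    ∀ (W : WeierstrassCurve ℚ) [W.IsElliptic] [W.IsGloballyMinimal] (p : ℕ) [Fact p.Prime]
      (D : KatoDescentDatum p) (ℒ : ℚ_[p]),
      W.analyticRank = 1 → p ≠ 2 → Addv W p → 0 ≤ padicValRat p W.j → ¬ p ∣ W.torsionOrder →
      Finite W.sha →
      R W p →
      IsKatoZetaDescentDatumOfContra W p D → Kato2004.PRRatio W p ℒ →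
      Finite (coinvariants p D.H2) ∧ (ℒ ≠ 0 ↔ D.zetaIndex ≠ 0) ∧
        ∀ m : ℕ, D.zetaIndex = p ^ m * D.h2Card →
          ℒ.valuation = (m : ℤ) +
            padicValNat p (Nat.card (AddCommGroup.primaryComponent W.sha p)) +
            padicValNat p W.tamagawaProduct := by
  intro W _ _ p _ D ℒ hr hp2 hadd hj htors hsha hRW hD hℒ
  have hall := hR W p hRW
  letI instC : ContinuousSMul ℤ_[p] (W.tateModule p) := TateModule.continuousSMul_padicInt
  letI instF : Module.Free ℤ_[p] (W.tateModule p) := W.module_free_tateModule_holds p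
  letI instFi : Module.Finite ℤ_[p] (W.tateModule p) := W.module_finite_tateModule_holds p
  have hpr : p.Prime := Fact.out
  -- the displays LOG-EX and LOG-HOM are theorems (Parts 7, 4)
  have hLogEx := logEx_of_gzk hGZK
  have hLogHom := ContraCount.logHom_display
  -- conjunct (i): from GZK alone (Part 8 §3)
  have hfinH2 : Finite (coinvariants p D.H2) := rankOneCountReading_finite_of_gzk hGZK W p D hr hsha hD
  -- the Mordell–Weil rank (Gross–Zagier–Kolyvagin)
  obtain ⟨hmw, -⟩ := hGZK W (by rw [hr])
  have hrank : W.mordellWeilRank = 1 := by rw [hmw, hr]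
  have hsha' : Finite (AddCommGroup.primaryComponent W.sha p) := by haveI := hsha; infer_instance
  -- the pin, the admissible class and its body
  obtain ⟨Pn, hadm, hH2⟩ := hD
  obtain ⟨hp', N', hN', f', hf', ι', q', Λ', hq', hZ', c', d₁', a', A', d'', hA', hc', hd', hdd', hR', z', x',
    hzeta', y', hy', qm, perRatio', e, u, n₁, n₂, n₃, n₄, σc, σd, σℓ, hqm, -, h₁, h₂, h₃, h₄, -, -, -, hper0',
    hper', he, hpos⟩ :=
    (Kato2004.isAdmissibleZetaClass_iff W p Pn.κ Pn.isCyclotomic Pn.I (Pn.eH D.z)).mp hadm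
  haveI : NeZero N' := hN'
  -- K1: the position clause at the bottom layer
  obtain ⟨c₁, c₂, hc₁, hc₂, hkey, hval⟩ := Pn.I.exists_proj_zero_smul_eq_of_position hf' c' d₁' a' A' d'' hq'
    hqm.ne' hper0' h₁ h₂ h₃ h₄ hR' σc σd σℓ he u hpos
  -- the generator `P` of the given witness (all its other data are discarded)
  obtain ⟨-, N, hN, f, -, -, -, -, -, -, c, d₁, a, A, d', -, -, -, -, -, -, -, -, K, hK, γK, -, IK, y, -, t, P,
    perRatio, -, hP, -, -⟩ := (Kato2004.prRatio_iff W p ℒ).mp hℒ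
  have hlogP := padicLogLocal_map_ne_zero_of_generates p hrank hP
  -- Kummer logarithms on the admissible side (LOG-EX)
  obtain ⟨t', ht'⟩ := hLogEx W p Pn.κ Pn.γ Pn.isCyclotomic Pn.isTopGenerator hr Pn.I y'
  obtain ⟨s, hs⟩ := hLogEx W p Pn.κ Pn.γ Pn.isCyclotomic Pn.isTopGenerator hr Pn.I (Pn.eH D.z)
  -- COUNT (7) at `x = z₀` DERIVED (in place of A2's display `hCount`): Thm. 12.4 (2) on the pin
  -- Thm. 12.4 (2) at the pin `Pn` from TREE THEOREMS ((12.2.1), torsion-freeness) and `D.z ≠ 0` (no `thm12_4`)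
  haveI := IwasawaH1Data.module_finite_of_isCyclotomic Pn.isCyclotomic Pn.isTopGenerator Pn.I
  haveI := Pn.I.isTorsionFree Pn.isTopGenerator
  haveI hntPn : Nontrivial Pn.I.H := nontrivial_of_ne (Pn.eH D.z) 0 (Pn.eH.map_ne_zero_iff.mpr D.z_ne_zero)
  haveI hfinJ : Finite (coinvariants p Pn.J.H2) := finite_coinvariants_H2_of_iwasawaH2Data W p Pn.J hrank hsha'
  -- the Kummer-log functional `φ`, `#ker φ = 1`, the index formula at `z₀`, conjunct (ii)
  obtain ⟨φ, v₀, hφ, -, hfinker, hφ0, hv₀⟩ := exists_kummerLog_range_eq W p Pn.J hrank hsha'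
  haveI := hfinker
  have hker : Nat.card (LinearMap.ker φ) = 1 :=
    kummerLog_injective_of_not_dvd_torsionOrder W p Pn.κ hrank hsha' htors φ hφ
  obtain ⟨hidxa, hidxb⟩ := natCard_quotient_ι_eq W p Pn.J φ hφ hφ0 hv₀ (Pn.eH D.z) hs
  have hii : s ≠ 0 ↔ Nat.card (Pn.J.A ⧸ (IwasawaAlgebra p) ∙ Pn.J.ι (Submodule.Quotient.mk (Pn.eH D.z))) ≠ 0 :=
    count_ii_of_iwasawaH2Data W p Pn.J hrank hsha' (Pn.eH D.z) hs
  -- the global Kummer class of `P`, E11's lattice exponent `a` with `v₀ = a + v(log_ω P)`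
  obtain ⟨xP, hxP⟩ := exists_forall_ofTopSubgroup_reduceH1Pk_eq_kummerMapTorsion W p (zsmul_pow_surjective W p) P
  obtain ⟨aP, haP, hv₀a⟩ :=
    exists_integralH1_eq_span_pow_smul_and_eq_add_valuation W p Pn.κ hrank hsha' htors hP hxP φ hφ hv₀
  -- H2X's package `(J₀, e₀)` over THIS pin (Imai finiteness by theorem), COUNT-X₀ at `J₀`, J-matched to `Pn.J`
  have hfix := finite_fixedPoints_kerSubgroup_inf_decomp W p hj Pn.κ Pn.isCyclotomic (primePlace p)
    (coe_primesEquiv_primePlace p)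
  obtain ⟨J₀, e₀, he₀, hfin₀⟩ := hH2X W p Pn.κ Pn.γ Pn.isTopGenerator (primePlace p) hp2 Pn.isCyclotomic
    (coe_primesEquiv_primePlace p) hfix Pn.I
  haveI : Finite (coinvariants p J₀.H2) := finite_coinvariants_H2_of_iwasawaH2Data W p J₀ hrank hsha'
  have hcountJ : KatoH2CountAt W p (Nat.card (coinvariants p Pn.J.H2)) :=
    (katoH2CountAt_iff_of_pinned_of_embedding W p Pn.isTopGenerator Pn.J hH2 J₀ e₀ he₀ hfin₀).mpr
      (hX₀ W p Pn.κ Pn.γ Pn.isCyclotomic Pn.isTopGenerator Pn.I J₀ e₀ hr hp2 hadd hj htors hsha hRW hntPn he₀ hfin₀)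
  -- Part 32: `v_p #(J.H2)_Γ + a = v_p #Ш[p^∞] + v_p Tam + v(log_ω P)` (Σ = the bad places ≠ v_p, all additive)
  obtain ⟨Q, hQp, hQadd, hQbad⟩ := exists_finset_badPlaces_ne W p hall
  have hcnt := padicValNat_add_eq_of_katoH2CountAt W p hp2 hadd hrank hsha' htors hP hxP Q hQp hQadd hQbad haP hcountJ
  -- conjunct (iii) in `s`-currency
  have hiii : ∀ m : ℕ, Nat.card (Pn.J.A ⧸ (IwasawaAlgebra p) ∙ Pn.J.ι (Submodule.Quotient.mk (Pn.eH D.z))) =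
      p ^ m * Nat.card (coinvariants p Pn.J.H2) →
      s.valuation = (m : ℤ) + padicValNat p (Nat.card (AddCommGroup.primaryComponent W.sha p)) +
        padicValNat p W.tamagawaProduct +
        2 * (padicLogLocal W p
          (WeierstrassCurve.Affine.Point.map (W' := W.toAffine) (S := ℚ) (Algebra.ofId ℚ ℚ_[p]) P)).valuation := by
    intro m hm
    have hcard_ne : Nat.card (Pn.J.A ⧸ (IwasawaAlgebra p) ∙ Pn.J.ι (Submodule.Quotient.mk (Pn.eH D.z))) ≠ 0 := by
      rw [hm]
      exact mul_ne_zero (pow_ne_zero _ hpr.ne_zero) Nat.card_pos.ne'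
    have hs0 : s ≠ 0 := fun h0 ↦ hcard_ne (hidxb h0)
    obtain ⟨hidx, hle⟩ := hidxa hs0
    have hkeyN : Nat.card (LinearMap.ker φ) * p ^ (s.valuation - v₀).toNat =
        p ^ m * Nat.card (coinvariants p Pn.J.H2) := by rw [← hidx, hm]
    rw [hker, one_mul] at hkeyN
    have hv := congrArg (padicValNat p) hkeyN
    rw [padicValNat.prime_pow, padicValNat.mul (pow_ne_zero _ hpr.ne_zero) Nat.card_pos.ne', padicValNat.prime_pow] at hv
    have hv' : ((s.valuation - v₀).toNat : ℤ) = (m : ℤ) + padicValNat p (Nat.card (coinvariants p Pn.J.H2)) := by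
      exact_mod_cast hv
    rw [Int.toNat_of_nonneg (sub_nonneg.mpr hle)] at hv'
    rw [hv₀a] at hv'
    linarith
  -- the admissible family is a second PRRatio witness
  set G : ℚ_[p] := padicLogLocal W p
    (WeierstrassCurve.Affine.Point.map (W' := W.toAffine) (S := ℚ) (Algebra.ofId ℚ ℚ_[p]) P) with hG
  set M : ℚ := q' * ratCuspFactor f' true c' d₁' a' A' d'' *
    ∏ ℓ ∈ (p * A').primeFactors, eulerFactorAtOne W N' ℓ with hM
  set ℒ' : ℚ_[p] := t' * ((perRatio' : ℚ) : ℚ_[p]) / ((M : ℚ) : ℚ_[p]) / G ^ 2 with hℒ'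
  have hℒ'w : Kato2004.PRRatio W p ℒ' :=
    (Kato2004.prRatio_iff W p ℒ').mpr ⟨hp', N', hN', f', hf', ι', q', Λ', hq', hZ', c', d₁', a', A', d'', hA',
      hc', hd', hdd', hR', z', x', hzeta', Pn.κ, Pn.isCyclotomic, Pn.γ, Pn.isTopGenerator, Pn.I, y', hy', t', P,
      perRatio', ht', hP, hper', by rw [hℒ', hM, hG]⟩
  -- witness independence (PR-INV)
  obtain ⟨w, hw, hℒw⟩ := hPRinv W p ℒ' ℒ hrank hsha' hℒ'w hℒ
  -- linearity of the Kummer logarithm (LOG-HOM) on K1's identity, moved to `H¹(⊤, T_pW)`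
  have hkey' : c₁ • layerZeroToTop W p Pn.κ (Pn.I.proj 0 (Pn.eH D.z)) =
      c₂ • layerZeroToTop W p Pn.κ (Pn.I.proj 0 y') := by
    have h := congrArg (fun v => layerZeroToTop W p Pn.κ v) hkey
    simp only [map_smul] at h
    exact h
  have hst : (c₁ : ℚ_[p]) * s = (c₂ : ℚ_[p]) * t' := hLogHom W p _ _ c₁ c₂ s t' hkey' hs ht'
  -- the indices along the pin
  have hidx := zetaIndex_eq_natCard_pin Pn; have hh2 := h2Card_eq_natCard_pin Pn
  -- non-vanishing of the constants
  have hc₁Q : (c₁ : ℚ_[p]) ≠ 0 := PadicInt.coe_ne_zero.mpr hc₁; have hc₂Q : (c₂ : ℚ_[p]) ≠ 0 := PadicInt.coe_ne_zero.mpr hc₂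
  have hw0 : w ≠ 0 := fun h => by rw [h, norm_zero] at hw; exact zero_ne_one hw
  have hE : ∀ ℓ ∈ (p * A').primeFactors, eulerFactorAtOne W N' ℓ ≠ 0 := fun ℓ hℓ =>
    eulerFactorAtOne_ne_zero W hf' (Nat.prime_of_mem_primeFactors hℓ)
  have hM0 : M ≠ 0 := mul_ne_zero (mul_ne_zero hq' hR') (Finset.prod_ne_zero_iff.mpr hE)
  have hMQ : ((M : ℚ) : ℚ_[p]) ≠ 0 := by exact_mod_cast hM0
  have hlamQ : ((perRatio' : ℚ) : ℚ_[p]) ≠ 0 := by exact_mod_cast hper0'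
  have hst' : s = 0 ↔ t' = 0 := by
    constructor
    · intro h0; rw [h0, mul_zero] at hst; exact (mul_eq_zero.mp hst.symm).resolve_left hc₂Q
    · intro h0; rw [h0, mul_zero] at hst; exact (mul_eq_zero.mp hst).resolve_left hc₁Q
  have hℒ'C : ℒ' = t' * (((perRatio' : ℚ) : ℚ_[p]) / ((M : ℚ) : ℚ_[p]) / G ^ 2) := by
    rw [hℒ']; ring
  have hC0 : ((perRatio' : ℚ) : ℚ_[p]) / ((M : ℚ) : ℚ_[p]) / G ^ 2 ≠ 0 :=
    div_ne_zero (div_ne_zero hlamQ hMQ) (pow_ne_zero 2 hlogP)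
  have hℒ't : ℒ' = 0 ↔ t' = 0 := by
    rw [hℒ'C, mul_eq_zero, or_iff_left hC0]
  refine ⟨hfinH2, ?_, ?_⟩
  · -- conjunct (ii)
    rw [hidx, ← hii, hℒw, mul_ne_zero_iff]
    exact ⟨fun h hs0 => h.2 (hℒ't.mpr (hst'.mp hs0)), fun h => ⟨hw0, fun h' => h (hst'.mpr (hℒ't.mp h'))⟩⟩
  · -- conjunct (iii)
    intro m hm
    rw [hidx, hh2] at hm
    have hsv := hiii m hm
    have hcard : Nat.card (Pn.J.A ⧸ (IwasawaAlgebra p) ∙ Pn.J.ι (Submodule.Quotient.mk (Pn.eH D.z))) ≠ 0 := by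
      rw [hm]
      exact mul_ne_zero (pow_ne_zero _ (Fact.out : p.Prime).ne_zero) Nat.card_pos.ne'
    have hs0 : s ≠ 0 := hii.mpr hcard
    have ht0 : t' ≠ 0 := fun h => hs0 (hst'.mpr h); have hℒ'0 : ℒ' ≠ 0 := fun h => ht0 (hℒ't.mp h)
    rw [hℒw, Padic.valuation_mul hw0 hℒ'0, valuation_eq_zero_of_norm_eq_one' hw, zero_add]
    have hvℒ' : ℒ'.valuation = t'.valuation + padicValRat p perRatio' - padicValRat p M - 2 * G.valuation := by
      rw [hℒ', valuation_mul_div_div_sq' ht0 hlamQ hMQ hlogP, Padic.valuation_ratCast, Padic.valuation_ratCast]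
    have hvs : (c₁ : ℚ_[p]).valuation + s.valuation = (c₂ : ℚ_[p]).valuation + t'.valuation := by
      have := congrArg Padic.valuation hst
      rwa [Padic.valuation_mul hc₁Q hs0, Padic.valuation_mul hc₂Q ht0] at this
    have hMeq : M = q' * ratCuspFactor f' true c' d₁' a' A' d'' *
        ∏ ℓ ∈ A'.primeFactors.erase p, eulerFactorAtOne W N' ℓ := by
      rw [hM, prod_eulerFactorAtOne_primeFactors_mul_eq_of_addv W p hadd (hlev N' hf') hA']
    have hρ : padicValRat p (perRatio' / (q' * ratCuspFactor f' true c' d₁' a' A' d'' *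
        ∏ ℓ ∈ A'.primeFactors.erase p, eulerFactorAtOne W N' ℓ)) = padicValRat p perRatio' - padicValRat p M := by
      rw [← hMeq, padicValRat.div hper0' hM0]
    rw [hρ] at hval; rw [hvℒ']; linarith

end Assembly

end Summit.BirchSwinnertonDyer.Rank1Residual.Additive.StrictCount

end
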